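import Summits.QuantumFields.BalabanUV.T4Continuum.Support.NE7LatticeHodgeGradient
import Summits.QuantumFields.BalabanUV.T4Continuum.Support.NE7ExpLogSecondOrder
import Summits.QuantumFields.BalabanUV.T4Continuum.Support.BlockAveragePushDirSplit
import HarnessLib

/-!
# T⁴ programme, row NE7 — (157) THE GRADIENT CURRENCY FROM THE SUP CURRENCY: for `W = e^{A}` with `sup‖A‖ ≤ ρ`,
# `‖∇A‖_∞ ≤ 4·(d·ρ∕R + R·(J + P))` from the flat lattice divergence `J` of the plaquette deviation `W(∂p) − 1` and the
# Landau reaction gradient `P` — on every torus, every radius `R` with `16dR(e^{4ρ} − 1) ≤ 1` (`NE7GradientCurrency`)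

Cell `pub-balaban`, rung (B)+1 sub-cell t4, row NE7.  Lineage `b2b-balaban-t4-ne7-p2` (CRUX PROVER NE7 #2 = co-owner of row NE7),
generation 88; second file of the chain (156)–(159) «THE GRADIENT CURRENCY `a₁` OF REP♭ IS NOT AN INDEPENDENT LETTER», over (156)
`NE7LatticeHodgeGradient.norm_fdiff_le_of_curl_div_global` and (154a) `NE7ExpLogSecondOrder.norm_expTail_sub_expTail_le`.

WHY.  (156) bounds `‖∇A‖` by `2(d·sup‖A‖∕R + R(J₀ + P))` with `J₀` the lattice co-differential of the LINEAR curl `dA`.  For the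
representative `W = e^{A}` of a gauge field the available datum is the NONLINEAR plaquette deviation `W(∂p) − 1 = e^{X₁}e^{X₂}e^{X₃}e^{X₄} − 1`
(`X = (A(x)_μ, A(x+e_μ)_ν, −A(x+e_ν)_μ, −A(x)_ν)`), whose linear part is `dA(x;μ,ν)` ([Balaban1985Averaging] p. 25; tree
`B7Prop1Explicit.walk_linear`).  The remainder `e^{X₁}⋯e^{X₄} − 1 − ΣXᵢ` is `O(ρ²)` in value AND `O(ρ)`-Lipschitz in `X` — §1 proves the
Lipschitz letter `‖Rem(X) − Rem(Y)‖ ≤ (e^{4ρ} − 1)·Σ‖Xᵢ − Yᵢ‖` in any complete normed `ℂ`-algebra with `‖1‖ = 1` — so a lattice difference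
of the remainder costs `(e^{4ρ} − 1)·4·‖∇A‖_∞`, which is ABSORBED on the left once `16dR(e^{4ρ} − 1) ≤ 1` (§3; with `R = M`, `ρ = a₀`:
`128·d·M·a₀ ≤ 1`, implied by the END's displayed lines `ω ≥ M(e^{a₀} − 1)`, `300(d+1)ω ≤ 1`).

WHAT ([folklore]; 0 def, 0 sorry):
* §1 (Banach algebra) `norm_conj_sub_self_le` (`‖L·D·R − D‖ ≤ (lr − 1)‖D‖`), `norm_mul_sub_one_le_of_le` (`‖gh − 1‖ ≤ pq − 1`),
  `norm_conj_exp_sub_exp_sub_le` (one factor: `‖L(eˣ − eʸ)R − (x − y)‖ ≤ (l·e^ρ·r − 1)‖x − y‖`), and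
  **`norm_plaqRem_sub_plaqRem_le`** (four factors: `(e^{4ρ} − 1)·Σ‖xᵢ − yᵢ‖`).
* §2 (T⁴ carriers, `W = vary flat A 1`) `hol_vary_flat_plaqWord` (the plaquette holonomy of `e^{A}` as the four-factor product),
  **`norm_fdiff_le_of_plaqDiv`** — with an A PRIORI gradient bound `G`: `‖∇A‖ ≤ 2(dρ∕R + R(J + 4d(e^{4ρ}−1)G + P))`.
* §3 **`norm_fdiff_le_of_plaqDiv_periodic`** — on a torus (`A` periodic) the maximal forward difference exists and is absorbed:
  `‖∇A‖_∞ ≤ 4(dρ∕R + R(J + P))` once `16dR(e^{4ρ} − 1) ≤ 1`; `norm_fdiff_le_of_plaqDiv_periodic'` — the same under `ρ ≤ 1∕64`,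
  `128dRρ ≤ 1` (`B7Prop1Explicit.exp4_sub_one_le`).
Here `J` bounds `Σ_μ [(W(∂p_{μν}(x)) − 1) − (W(∂p_{μν}(x − e_μ)) − 1)]` (ALL ordered pairs `μ, ν`; the flat lattice co-differential of the
plaquette deviation; (158) converts the gauge-COVARIANT divergence [Balaban1985RegularSpaces] (1.2) `B8Ineq132.covDiv` of `U` into it) and
`P` bounds `div A(x + e_ν) − div A(x)`, `div A(x) = Σ_μ (A(x)_μ − A(x−e_μ)_μ)` (the Landau reaction; `P = 0` in an exact lattice Landau gauge).

HONEST FRAMING (page 1): elementary lattice ∕ Banach-algebra analysis of OUR objects; nothing of Bałaban's is used or claimed; the sup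
currency `ρ = a₀`, the divergence datum `J` and the reaction `P` are HYPOTHESES here ((158)–(159) dock them to THE END); (APE) NOT proved;
NE7 NOT PRINTED ∕ NOT PROVED; spine 0∕9; finite T⁴ rung (B)+1 — NOT infinite volume, NOT mass gap, NOT Clay.
Continuum YM on T⁴ ⇐ BetaPertH ∧ nine spine estimates (0/9 proved); BetaPertH ⇐ (D1) ∧ (D4) ∧ CAP+tail; G-an2-4 gates asym, D1 and NE2/3/4.
No `sorry`; axioms ⊆ {propext, Classical.choice, Quot.sound}.  PLACEMENT: our lemma, under `Summits/QuantumFields/BalabanUV/`.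
-/

set_option autoImplicit false

open NormedSpace
open scoped BigOperators Matrix.Norms.L2Operator
open Finset

namespace Summit.QuantumFields.BalabanUV.T4Continuum.NE7GradientCurrency

open Literature.MathematicalPhysics.QuantumFieldTheory.Balaban1983to89
open B7Prop1Explicit
open T4AveragingDeficitWall (vary)
open T4AveragingDeficitWallBoundary (periodBox mem_periodBox)
open AveragingDeficitPeriodicCounting (IsPeriodicDir)
open AveragingDeficitTorusChart (periodic_smul_vec)
open SkeletonLattice (cdiv cmod smul_cdiv_add_cmod cmod_nonneg cmod_lt)
open BlockAveragePushDirSplit (flat)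
open NE7ExpLogSecondOrder (norm_expTail_sub_expTail_le)
open NE7LatticeHodgeGradient (norm_fdiff_le_of_curl_div_global)

noncomputable section

/-! ## §1 Second-order Lipschitz letters for products of exponentials in a Banach algebra -/

section Algebra

variable {𝔸 : Type*} [NormedRing 𝔸] [NormedAlgebra ℂ 𝔸] [CompleteSpace 𝔸] [NormOneClass 𝔸]

omit [NormedAlgebra ℂ 𝔸] [CompleteSpace 𝔸] in
/-- `‖L·D·R − D‖ ≤ (l·r − 1)·‖D‖` when `‖L − 1‖ ≤ l − 1`, `‖R − 1‖ ≤ r − 1`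
(`LDR − D = (L − 1)DR + D(R − 1)`, `‖R‖ ≤ ‖R − 1‖ + 1`). [folklore] -/
theorem norm_conj_sub_self_le {L R D : 𝔸} {l r : ℝ} (hL : ‖L - 1‖ ≤ l - 1) (hR : ‖R - 1‖ ≤ r - 1) :
    ‖L * D * R - D‖ ≤ (l * r - 1) * ‖D‖ := by
  have hid : L * D * R - D = (L - 1) * D * R + D * (R - 1) := by noncomm_ring
  have hRn : ‖R‖ ≤ r := by
    have h := norm_le_norm_add_norm_sub' R 1
    rw [norm_one] at h
    linarith
  have hl : 0 ≤ l - 1 := (norm_nonneg _).trans hL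
  have h1 : ‖(L - 1) * D * R‖ ≤ (l - 1) * ‖D‖ * r :=
    calc ‖(L - 1) * D * R‖ ≤ ‖L - 1‖ * ‖D‖ * ‖R‖ :=
          (norm_mul_le _ _).trans (mul_le_mul_of_nonneg_right (norm_mul_le _ _) (norm_nonneg _))
      _ ≤ (l - 1) * ‖D‖ * r :=
          mul_le_mul (mul_le_mul_of_nonneg_right hL (norm_nonneg _)) hRn (norm_nonneg _) (mul_nonneg hl (norm_nonneg _))
  have h2 : ‖D * (R - 1)‖ ≤ ‖D‖ * (r - 1) := (norm_mul_le _ _).trans (mul_le_mul_of_nonneg_left hR (norm_nonneg _))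
  rw [hid]
  calc ‖(L - 1) * D * R + D * (R - 1)‖ ≤ (l - 1) * ‖D‖ * r + ‖D‖ * (r - 1) := (norm_add_le _ _).trans (add_le_add h1 h2)
    _ = (l * r - 1) * ‖D‖ := by ring

omit [NormedAlgebra ℂ 𝔸] [CompleteSpace 𝔸] [NormOneClass 𝔸] in
/-- `‖g·h − 1‖ ≤ p·q − 1` when `‖g − 1‖ ≤ p − 1`, `‖h − 1‖ ≤ q − 1` (`B7Prop6Bound.mul_sub_one_norm_le`). [folklore] -/
theorem norm_mul_sub_one_le_of_le {g h : 𝔸} {p q : ℝ} (hg : ‖g - 1‖ ≤ p - 1) (hh : ‖h - 1‖ ≤ q - 1) :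
    ‖g * h - 1‖ ≤ p * q - 1 := by
  have h1 := B7Prop6Bound.mul_sub_one_norm_le g h
  have hp : 1 + ‖g - 1‖ ≤ p := by linarith
  have hq : 1 + ‖h - 1‖ ≤ q := by linarith
  have h2 : (1 + ‖g - 1‖) * (1 + ‖h - 1‖) ≤ p * q :=
    mul_le_mul hp hq (by positivity) ((by positivity : (0 : ℝ) ≤ 1 + ‖g - 1‖).trans hp)
  linarith

omit [NormOneClass 𝔸] in
/-- `‖eˣ − 1‖ ≤ e^ρ − 1` on `‖x‖ ≤ ρ` (`B7Prop1Explicit.norm_exp_sub_one_le_of_norm_le`). [folklore] -/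
theorem norm_exp_sub_one_le {x : 𝔸} {ρ : ℝ} (hx : ‖x‖ ≤ ρ) : ‖exp x - 1‖ ≤ Real.exp ρ - 1 :=
  (norm_exp_sub_one_le_of_norm_le hx).1

/-- **ONE FACTOR**: `‖L·(eˣ − eʸ)·R − (x − y)‖ ≤ (l·e^ρ·r − 1)·‖x − y‖` on `‖x‖, ‖y‖ ≤ ρ`, `‖L − 1‖ ≤ l − 1`, `‖R − 1‖ ≤ r − 1`
(`eˣ − eʸ = (T x − T y) + (x − y)` with the tail `T x = eˣ − 1 − x`, (154a)'s `‖T x − T y‖ ≤ (e^ρ − 1)‖x − y‖`, and `norm_conj_sub_self_le`).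
[folklore] -/
theorem norm_conj_exp_sub_exp_sub_le {L R x y : 𝔸} {l r ρ : ℝ} (hx : ‖x‖ ≤ ρ) (hy : ‖y‖ ≤ ρ)
    (hL : ‖L - 1‖ ≤ l - 1) (hR : ‖R - 1‖ ≤ r - 1) :
    ‖L * (exp x - exp y) * R - (x - y)‖ ≤ (l * Real.exp ρ * r - 1) * ‖x - y‖ := by
  have hT := norm_expTail_sub_expTail_le hx hy
  have hid : L * (exp x - exp y) * R - (x - y)
      = L * ((exp x - 1 - x) - (exp y - 1 - y)) * R + (L * (x - y) * R - (x - y)) := by noncomm_ring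
  have hLn : ‖L‖ ≤ l := by
    have h := norm_le_norm_add_norm_sub' L 1
    rw [norm_one] at h
    linarith
  have hRn : ‖R‖ ≤ r := by
    have h := norm_le_norm_add_norm_sub' R 1
    rw [norm_one] at h
    linarith
  have hl0 : 0 ≤ l := (norm_nonneg _).trans hLn
  have hρ1 : 0 ≤ Real.exp ρ - 1 := by
    have hρ0 : 0 ≤ ρ := (norm_nonneg _).trans hx
    have := Real.add_one_le_exp ρ
    linarith
  have h1 : ‖L * ((exp x - 1 - x) - (exp y - 1 - y)) * R‖ ≤ l * ((Real.exp ρ - 1) * ‖x - y‖) * r :=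
    calc ‖L * ((exp x - 1 - x) - (exp y - 1 - y)) * R‖ ≤ ‖L‖ * ‖(exp x - 1 - x) - (exp y - 1 - y)‖ * ‖R‖ :=
          (norm_mul_le _ _).trans (mul_le_mul_of_nonneg_right (norm_mul_le _ _) (norm_nonneg _))
      _ ≤ l * ((Real.exp ρ - 1) * ‖x - y‖) * r :=
          mul_le_mul (mul_le_mul hLn hT (norm_nonneg _) hl0) hRn (norm_nonneg _)
            (mul_nonneg hl0 (mul_nonneg hρ1 (norm_nonneg _)))
  have h2 : ‖L * (x - y) * R - (x - y)‖ ≤ (l * r - 1) * ‖x - y‖ := norm_conj_sub_self_le hL hR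
  rw [hid]
  calc ‖L * ((exp x - 1 - x) - (exp y - 1 - y)) * R + (L * (x - y) * R - (x - y))‖
      ≤ l * ((Real.exp ρ - 1) * ‖x - y‖) * r + (l * r - 1) * ‖x - y‖ := (norm_add_le _ _).trans (add_le_add h1 h2)
    _ = (l * Real.exp ρ * r - 1) * ‖x - y‖ := by ring

/-- **FOUR FACTORS — THE LIPSCHITZ LETTER OF THE PLAQUETTE REMAINDER**: on `‖xᵢ‖, ‖yᵢ‖ ≤ ρ`,
`‖(e^{x₁}e^{x₂}e^{x₃}e^{x₄} − 1 − Σxᵢ) − (e^{y₁}e^{y₂}e^{y₃}e^{y₄} − 1 − Σyᵢ)‖ ≤ (e^{4ρ} − 1)·Σᵢ‖xᵢ − yᵢ‖` — mixed telescoping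
`Πe^{xᵢ} − Πe^{yᵢ} = Σᵢ e^{x₁}⋯e^{x_{i−1}}(e^{xᵢ} − e^{yᵢ})e^{y_{i+1}}⋯e^{y₄}` and `norm_conj_exp_sub_exp_sub_le` with `l·e^ρ·r = e^{4ρ}`
for each summand. [folklore] -/
theorem norm_plaqRem_sub_plaqRem_le {x₁ x₂ x₃ x₄ y₁ y₂ y₃ y₄ : 𝔸} {ρ : ℝ}
    (hx₁ : ‖x₁‖ ≤ ρ) (hx₂ : ‖x₂‖ ≤ ρ) (hx₃ : ‖x₃‖ ≤ ρ) (hx₄ : ‖x₄‖ ≤ ρ)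
    (hy₁ : ‖y₁‖ ≤ ρ) (hy₂ : ‖y₂‖ ≤ ρ) (hy₃ : ‖y₃‖ ≤ ρ) (hy₄ : ‖y₄‖ ≤ ρ) :
    ‖(exp x₁ * exp x₂ * exp x₃ * exp x₄ - 1 - (x₁ + x₂ + x₃ + x₄))
        - (exp y₁ * exp y₂ * exp y₃ * exp y₄ - 1 - (y₁ + y₂ + y₃ + y₄))‖
      ≤ (Real.exp (4 * ρ) - 1) * (‖x₁ - y₁‖ + ‖x₂ - y₂‖ + ‖x₃ - y₃‖ + ‖x₄ - y₄‖) := by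
  set q : ℝ := Real.exp ρ with hq
  have h4 : Real.exp (4 * ρ) = q * q * q * q := by
    rw [hq, show (4 : ℝ) * ρ = ρ + ρ + ρ + ρ by ring, Real.exp_add, Real.exp_add, Real.exp_add]
  -- the factors are within `q − 1`, `q² − 1`, `q³ − 1` of `1`
  have ex₁ : ‖exp x₁ - 1‖ ≤ q - 1 := norm_exp_sub_one_le hx₁
  have ex₂ : ‖exp x₂ - 1‖ ≤ q - 1 := norm_exp_sub_one_le hx₂
  have ex₃ : ‖exp x₃ - 1‖ ≤ q - 1 := norm_exp_sub_one_le hx₃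
  have ey₂ : ‖exp y₂ - 1‖ ≤ q - 1 := norm_exp_sub_one_le hy₂
  have ey₃ : ‖exp y₃ - 1‖ ≤ q - 1 := norm_exp_sub_one_le hy₃
  have ey₄ : ‖exp y₄ - 1‖ ≤ q - 1 := norm_exp_sub_one_le hy₄
  have hx12 : ‖exp x₁ * exp x₂ - 1‖ ≤ q * q - 1 := norm_mul_sub_one_le_of_le ex₁ ex₂
  have hx123 : ‖exp x₁ * exp x₂ * exp x₃ - 1‖ ≤ q * q * q - 1 := norm_mul_sub_one_le_of_le hx12 ex₃
  have hy34 : ‖exp y₃ * exp y₄ - 1‖ ≤ q * q - 1 := norm_mul_sub_one_le_of_le ey₃ ey₄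
  have hy234 : ‖exp y₂ * (exp y₃ * exp y₄) - 1‖ ≤ q * (q * q) - 1 := norm_mul_sub_one_le_of_le ey₂ hy34
  have hone : ‖(1 : 𝔸) - 1‖ ≤ (1 : ℝ) - 1 := by rw [sub_self, norm_zero, sub_self]
  -- the four summands
  have t₁ := norm_conj_exp_sub_exp_sub_le (L := 1) (R := exp y₂ * (exp y₃ * exp y₄)) hx₁ hy₁ hone hy234
  have t₂ := norm_conj_exp_sub_exp_sub_le (L := exp x₁) (R := exp y₃ * exp y₄) hx₂ hy₂ ex₁ hy34
  have t₃ := norm_conj_exp_sub_exp_sub_le (L := exp x₁ * exp x₂) (R := exp y₄) hx₃ hy₃ hx12 ey₄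
  have t₄ := norm_conj_exp_sub_exp_sub_le (L := exp x₁ * exp x₂ * exp x₃) (R := 1) hx₄ hy₄ hx123 hone
  rw [← hq] at t₁ t₂ t₃ t₄
  have e₁ : (1 * q * (q * (q * q)) - 1) = q * q * q * q - 1 := by ring
  have e₂ : (q * q * (q * q) - 1) = q * q * q * q - 1 := by ring
  have e₃ : (q * q * q * q - 1) = q * q * q * q - 1 := rfl
  have e₄ : (q * q * q * q * 1 - 1) = q * q * q * q - 1 := by ring
  rw [e₁] at t₁; rw [e₂] at t₂; rw [e₄] at t₄
  have hid : (exp x₁ * exp x₂ * exp x₃ * exp x₄ - 1 - (x₁ + x₂ + x₃ + x₄))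
        - (exp y₁ * exp y₂ * exp y₃ * exp y₄ - 1 - (y₁ + y₂ + y₃ + y₄))
      = (1 * (exp x₁ - exp y₁) * (exp y₂ * (exp y₃ * exp y₄)) - (x₁ - y₁))
        + (exp x₁ * (exp x₂ - exp y₂) * (exp y₃ * exp y₄) - (x₂ - y₂))
        + (exp x₁ * exp x₂ * (exp x₃ - exp y₃) * exp y₄ - (x₃ - y₃))
        + (exp x₁ * exp x₂ * exp x₃ * (exp x₄ - exp y₄) * 1 - (x₄ - y₄)) := by noncomm_ring
  rw [hid, h4]
  calc _ ≤ ‖1 * (exp x₁ - exp y₁) * (exp y₂ * (exp y₃ * exp y₄)) - (x₁ - y₁)‖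
          + ‖exp x₁ * (exp x₂ - exp y₂) * (exp y₃ * exp y₄) - (x₂ - y₂)‖
          + ‖exp x₁ * exp x₂ * (exp x₃ - exp y₃) * exp y₄ - (x₃ - y₃)‖
          + ‖exp x₁ * exp x₂ * exp x₃ * (exp x₄ - exp y₄) * 1 - (x₄ - y₄)‖ :=
        (norm_add_le _ _).trans (add_le_add ((norm_add_le _ _).trans (add_le_add (norm_add_le _ _) le_rfl)) le_rfl)
    _ ≤ (q * q * q * q - 1) * ‖x₁ - y₁‖ + (q * q * q * q - 1) * ‖x₂ - y₂‖
          + (q * q * q * q - 1) * ‖x₃ - y₃‖ + (q * q * q * q - 1) * ‖x₄ - y₄‖ :=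
        add_le_add (add_le_add (add_le_add t₁ t₂) t₃) t₄
    _ = (q * q * q * q - 1) * (‖x₁ - y₁‖ + ‖x₂ - y₂‖ + ‖x₃ - y₃‖ + ‖x₄ - y₄‖) := by ring

end Algebra

/-! ## §2 The representative `W = e^{A}` on the T⁴ carriers: the gradient from the plaquette divergence, with an a priori gradient bound -/

section Carriers

variable {d : ℕ} {n : Type*} [Fintype n] [DecidableEq n] [Nonempty n]

local notation "𝕄" => Matrix n n ℂ

omit [Nonempty n] in
/-- The bonds of `W = vary flat A 1` are `e^{A(b)}`. [folklore] -/
theorem vary_flat_one_apply (A : Site d → Fin d → 𝕄) (x : Site d) (μ : Fin d) :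
    vary (flat (d := d) (n := n)) A 1 x μ = expUnit (A x μ) := by
  unfold vary
  rw [show (flat (d := d) (n := n)) x μ = 1 from rfl, one_mul, Complex.ofReal_one, one_smul]

omit [Nonempty n] in
/-- **THE PLAQUETTE HOLONOMY OF `e^{A}` IS THE FOUR-FACTOR PRODUCT** `e^{A(x)_μ} e^{A(x+e_μ)_ν} e^{−A(x+e_ν)_μ} e^{−A(x)_ν}`
(for every ordered pair `μ, ν`; `B7Prop1Local.hol_plaqWord_eq`). [folklore] -/
theorem hol_vary_flat_plaqWord (A : Site d → Fin d → 𝕄) (x : Site d) (μ ν : Fin d) :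
    ((hol (vary (flat (d := d) (n := n)) A 1) x (plaqWord μ ν) : 𝕄ˣ) : 𝕄)
      = exp (A x μ) * exp (A (x + e μ) ν) * exp (-A (x + e ν) μ) * exp (-A x ν) := by
  rw [B7Prop1Local.hol_plaqWord_eq]
  simp only [vary_flat_one_apply, Units.val_mul, val_inv_expUnit, val_expUnit]

/-- **THE GRADIENT OF `A` FROM THE PLAQUETTE DIVERGENCE OF `e^{A}`, WITH AN A PRIORI GRADIENT BOUND.**  For `A : ℤᵈ → (Fin d → 𝕄)` with
`‖A‖ ≤ ρ`, an a priori bound `G` on all forward differences, `J` a bound on the flat lattice co-differential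
`Σ_μ [(W(∂p_{μν}(x)) − 1) − (W(∂p_{μν}(x−e_μ)) − 1)]` of the plaquette deviation of `W = e^{A}`, and `P` a bound on the forward
difference of the divergence `div A`: every forward difference obeys `‖A(x+e_τ)_κ − A(x)_κ‖ ≤ 2·(d·ρ∕R + R·(J + 4d(e^{4ρ} − 1)G + P))`
for every `R ≥ 1` ((156) with the curl written as plaquette deviation minus remainder, §1 for the remainder's differences). [folklore] -/
theorem norm_fdiff_le_of_plaqDiv (A : Site d → Fin d → 𝕄) {ρ G J P : ℝ}
    (hA : ∀ (x : Site d) (κ : Fin d), ‖A x κ‖ ≤ ρ)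
    (hG : ∀ (x : Site d) (κ τ : Fin d), ‖A (x + e τ) κ - A x κ‖ ≤ G)
    (hJ : ∀ (x : Site d) (ν : Fin d),
      ‖∑ μ, ((((hol (vary (flat (d := d) (n := n)) A 1) x (plaqWord μ ν) : 𝕄ˣ) : 𝕄) - 1)
              - (((hol (vary (flat (d := d) (n := n)) A 1) (x - e μ) (plaqWord μ ν) : 𝕄ˣ) : 𝕄) - 1))‖ ≤ J)
    (hP : ∀ (x : Site d) (ν : Fin d), ‖∑ μ, (A (x + e ν) μ - A (x + e ν - e μ) μ) - ∑ μ, (A x μ - A (x - e μ) μ)‖ ≤ P)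
    {R : ℕ} (hR : 1 ≤ R) (x : Site d) (κ τ : Fin d) :
    ‖A (x + e τ) κ - A x κ‖ ≤ 2 * ((d : ℝ) * ρ / R + R * ((J + 4 * d * (Real.exp (4 * ρ) - 1) * G) + P)) := by
  refine norm_fdiff_le_of_curl_div_global (E := 𝕄) A hR (fun y ν => hA y ν) (fun y ν => ?_) hP x κ τ
  -- the curl as plaquette deviation minus remainder
  set W := vary (flat (d := d) (n := n)) A 1 with hW
  have hrem : ∀ (z : Site d) (μ : Fin d),
      (A z μ + A (z + e μ) ν - A (z + e ν) μ - A z ν)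
        = (((hol W z (plaqWord μ ν) : 𝕄ˣ) : 𝕄) - 1)
          - (exp (A z μ) * exp (A (z + e μ) ν) * exp (-A (z + e ν) μ) * exp (-A z ν) - 1
              - (A z μ + A (z + e μ) ν + -A (z + e ν) μ + -A z ν)) := by
    intro z μ
    rw [hW, hol_vary_flat_plaqWord]
    abel
  have hG0 : 0 ≤ G := (norm_nonneg _).trans (hG y ν ν)
  -- the remainder difference, summand by summand
  have hdiff : ∀ μ : Fin d,
      ‖(exp (A y μ) * exp (A (y + e μ) ν) * exp (-A (y + e ν) μ) * exp (-A y ν) - 1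
            - (A y μ + A (y + e μ) ν + -A (y + e ν) μ + -A y ν))
        - (exp (A (y - e μ) μ) * exp (A (y - e μ + e μ) ν) * exp (-A (y - e μ + e ν) μ) * exp (-A (y - e μ) ν) - 1
            - (A (y - e μ) μ + A (y - e μ + e μ) ν + -A (y - e μ + e ν) μ + -A (y - e μ) ν))‖
        ≤ (Real.exp (4 * ρ) - 1) * (4 * G) := by
    intro μ
    have h := norm_plaqRem_sub_plaqRem_le (hA y μ) (hA (y + e μ) ν) (by rw [norm_neg]; exact hA (y + e ν) μ)
      (by rw [norm_neg]; exact hA y ν) (hA (y - e μ) μ) (hA (y - e μ + e μ) ν)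
      (by rw [norm_neg]; exact hA (y - e μ + e ν) μ) (by rw [norm_neg]; exact hA (y - e μ) ν)
    refine h.trans (mul_le_mul_of_nonneg_left ?_ ?_)
    · have h1 : ‖A y μ - A (y - e μ) μ‖ ≤ G := by
        have := hG (y - e μ) μ μ; rwa [sub_add_cancel] at this
      have h2 : ‖A (y + e μ) ν - A (y - e μ + e μ) ν‖ ≤ G := by
        have := hG (y - e μ + e μ) ν μ
        simp only [sub_add_cancel] at this ⊢
        exact this
      have h3 : ‖-A (y + e ν) μ - -A (y - e μ + e ν) μ‖ ≤ G := by
        have := hG (y - e μ + e ν) μ μ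
        rw [show y - e μ + e ν + e μ = y + e ν by abel] at this
        rw [show -A (y + e ν) μ - -A (y - e μ + e ν) μ = -(A (y + e ν) μ - A (y - e μ + e ν) μ) by abel, norm_neg]
        exact this
      have h4 : ‖-A y ν - -A (y - e μ) ν‖ ≤ G := by
        have := hG (y - e μ) ν μ
        rw [sub_add_cancel] at this
        rw [show -A y ν - -A (y - e μ) ν = -(A y ν - A (y - e μ) ν) by abel, norm_neg]
        exact this
      linarith
    · have hρ0 : 0 ≤ ρ := (norm_nonneg _).trans (hA y ν)
      have := Real.one_le_exp (by positivity : 0 ≤ 4 * ρ)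
      linarith
  -- assemble
  have hsplit : ∑ μ, ((A y μ + A (y + e μ) ν - A (y + e ν) μ - A y ν)
        - (A (y - e μ) μ + A (y - e μ + e μ) ν - A (y - e μ + e ν) μ - A (y - e μ) ν))
      = ∑ μ, ((((hol W y (plaqWord μ ν) : 𝕄ˣ) : 𝕄) - 1) - (((hol W (y - e μ) (plaqWord μ ν) : 𝕄ˣ) : 𝕄) - 1))
        - ∑ μ, ((exp (A y μ) * exp (A (y + e μ) ν) * exp (-A (y + e ν) μ) * exp (-A y ν) - 1
            - (A y μ + A (y + e μ) ν + -A (y + e ν) μ + -A y ν))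
          - (exp (A (y - e μ) μ) * exp (A (y - e μ + e μ) ν) * exp (-A (y - e μ + e ν) μ) * exp (-A (y - e μ) ν) - 1
            - (A (y - e μ) μ + A (y - e μ + e μ) ν + -A (y - e μ + e ν) μ + -A (y - e μ) ν))) := by
    rw [← Finset.sum_sub_distrib]
    refine Finset.sum_congr rfl fun μ _ => ?_
    rw [hrem y μ, hrem (y - e μ) μ]
    abel
  rw [hsplit]
  refine (norm_sub_le _ _).trans ?_
  have hsum : ‖∑ μ : Fin d, ((exp (A y μ) * exp (A (y + e μ) ν) * exp (-A (y + e ν) μ) * exp (-A y ν) - 1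
            - (A y μ + A (y + e μ) ν + -A (y + e ν) μ + -A y ν))
          - (exp (A (y - e μ) μ) * exp (A (y - e μ + e μ) ν) * exp (-A (y - e μ + e ν) μ) * exp (-A (y - e μ) ν) - 1
            - (A (y - e μ) μ + A (y - e μ + e μ) ν + -A (y - e μ + e ν) μ + -A (y - e μ) ν)))‖
      ≤ 4 * d * (Real.exp (4 * ρ) - 1) * G := by
    refine (norm_sum_le _ _).trans ?_
    calc _ ≤ ∑ _μ : Fin d, (Real.exp (4 * ρ) - 1) * (4 * G) := Finset.sum_le_sum fun μ _ => hdiff μ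
      _ = 4 * d * (Real.exp (4 * ρ) - 1) * G := by
          rw [Finset.sum_const, Finset.card_univ, Fintype.card_fin, nsmul_eq_mul]; ring
  exact add_le_add (hJ y ν) hsum

end Carriers

/-! ## §3 On a torus: the maximal forward difference is absorbed -/

section Torus

variable {d : ℕ} {n : Type*} [Fintype n] [DecidableEq n] [Nonempty n]

local notation "𝕄" => Matrix n n ℂ

/-- **THE GRADIENT CURRENCY FROM THE SUP CURRENCY ON A TORUS.**  For a `Per`-periodic `A : ℤᵈ → (Fin d → 𝕄)` (`Per ≥ 1`, `d ≥ 1`) with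
`‖A‖ ≤ ρ`, plaquette-divergence datum `J` for `W = e^{A}` and reaction-gradient `P` as in `norm_fdiff_le_of_plaqDiv`, and a radius `R ≥ 1`
with `16·d·R·(e^{4ρ} − 1) ≤ 1`: `‖A(x+e_τ)_κ − A(x)_κ‖ ≤ 4·(d·ρ∕R + R·(J + P))` at every bond and direction — the a priori gradient
bound of §2 taken at the MAXIMISING forward difference over one period and absorbed on the left. [folklore] -/
theorem norm_fdiff_le_of_plaqDiv_periodic (hd : 1 ≤ d) {Per : ℕ} (hPer : 1 ≤ Per) (A : Site d → Fin d → 𝕄)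
    (hAP : IsPeriodicDir A (Per : ℤ)) {ρ J P : ℝ}
    (hA : ∀ (x : Site d) (κ : Fin d), ‖A x κ‖ ≤ ρ)
    (hJ : ∀ (x : Site d) (ν : Fin d),
      ‖∑ μ, ((((hol (vary (flat (d := d) (n := n)) A 1) x (plaqWord μ ν) : 𝕄ˣ) : 𝕄) - 1)
              - (((hol (vary (flat (d := d) (n := n)) A 1) (x - e μ) (plaqWord μ ν) : 𝕄ˣ) : 𝕄) - 1))‖ ≤ J)
    (hP : ∀ (x : Site d) (ν : Fin d), ‖∑ μ, (A (x + e ν) μ - A (x + e ν - e μ) μ) - ∑ μ, (A x μ - A (x - e μ) μ)‖ ≤ P)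
    {R : ℕ} (hR : 1 ≤ R) (hsmall : 16 * (d : ℝ) * R * (Real.exp (4 * ρ) - 1) ≤ 1) (x : Site d) (κ τ : Fin d) :
    ‖A (x + e τ) κ - A x κ‖ ≤ 4 * ((d : ℝ) * ρ / R + R * (J + P)) := by
  classical
  -- the maximal forward difference over one period
  set S : Finset (Site d × Fin d × Fin d) :=
    (periodBox (d := d) Per) ×ˢ ((Finset.univ : Finset (Fin d)) ×ˢ (Finset.univ : Finset (Fin d))) with hS_def
  have hmemS : ∀ (y : Site d) (i j : Fin d), (cmod Per y, i, j) ∈ S := fun y i j => by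
    rw [hS_def, Finset.mem_product, Finset.mem_product]
    exact ⟨(mem_periodBox).2 fun k => ⟨cmod_nonneg hPer y k, cmod_lt hPer y k⟩, Finset.mem_univ _, Finset.mem_univ _⟩
  have hSne : S.Nonempty := ⟨_, hmemS 0 ⟨0, hd⟩ ⟨0, hd⟩⟩
  obtain ⟨q₀, -, hq₀max⟩ := Finset.exists_max_image S (fun q => ‖A (q.1 + e q.2.2) q.2.1 - A q.1 q.2.1‖) hSne
  set G : ℝ := ‖A (q₀.1 + e q₀.2.2) q₀.2.1 - A q₀.1 q₀.2.1‖ with hG_def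
  -- every forward difference is bounded by `G` (reduce to the period box by periodicity)
  have hGall : ∀ (y : Site d) (i j : Fin d), ‖A (y + e j) i - A y i‖ ≤ G := by
    intro y i j
    have hy : y = cmod Per y + (Per : ℤ) • cdiv Per y := by rw [add_comm, smul_cdiv_add_cmod]
    have h1 : A y i = A (cmod Per y) i := by
      have h := periodic_smul_vec (f := fun z => A z i) (N := (Per : ℤ)) (fun y' i' => hAP y' i' i) (cmod Per y) (cdiv Per y)
      rwa [← hy] at h
    have hye : y + e j = (cmod Per y + e j) + (Per : ℤ) • cdiv Per y := by
      have h : y + e j = (cmod Per y + (Per : ℤ) • cdiv Per y) + e j := by rw [← hy]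
      rw [h]; abel
    have h2 : A (y + e j) i = A (cmod Per y + e j) i := by
      have h := periodic_smul_vec (f := fun z => A z i) (N := (Per : ℤ)) (fun y' i' => hAP y' i' i) (cmod Per y + e j) (cdiv Per y)
      rw [hye, h]
    rw [h1, h2]
    have hm := hq₀max (cmod Per y, i, j) (hmemS y i j)
    simpa only using hm
  -- §2 at the maximising bond, then absorb
  have hkey : G ≤ 2 * ((d : ℝ) * ρ / R + R * ((J + 4 * d * (Real.exp (4 * ρ) - 1) * G) + P)) :=
    norm_fdiff_le_of_plaqDiv A hA (fun y i j => hGall y i j) hJ hP hR q₀.1 q₀.2.1 q₀.2.2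
  have hR0 : (0 : ℝ) < R := by exact_mod_cast hR
  have hρ0 : 0 ≤ ρ := (norm_nonneg _).trans (hA 0 ⟨0, hd⟩)
  have hE : 0 ≤ Real.exp (4 * ρ) - 1 := by
    have := Real.one_le_exp (by positivity : 0 ≤ 4 * ρ); linarith
  have hG0 : 0 ≤ G := norm_nonneg _
  have habs : 2 * (R * (4 * d * (Real.exp (4 * ρ) - 1) * G)) ≤ G / 2 := by
    have h1 : (16 * (d : ℝ) * R * (Real.exp (4 * ρ) - 1)) * G ≤ 1 * G := mul_le_mul_of_nonneg_right hsmall hG0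
    have h2 : 2 * (R * (4 * d * (Real.exp (4 * ρ) - 1) * G)) = (16 * (d : ℝ) * R * (Real.exp (4 * ρ) - 1)) * G / 2 := by ring
    rw [h2]
    linarith
  have hGle : G ≤ 4 * ((d : ℝ) * ρ / R + R * (J + P)) := by
    have h2 : 2 * ((d : ℝ) * ρ / R + R * ((J + 4 * d * (Real.exp (4 * ρ) - 1) * G) + P))
        = 2 * ((d : ℝ) * ρ / R + R * (J + P)) + 2 * (R * (4 * d * (Real.exp (4 * ρ) - 1) * G)) := by ring
    rw [h2] at hkey
    linarith
  exact (hGall x κ τ).trans hGle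

/-- **THE GRADIENT CURRENCY FROM THE SUP CURRENCY ON A TORUS, LINEARISED SMALLNESS**: the same with the condition in the form
`ρ ≤ 1∕64`, `128·d·R·ρ ≤ 1` (`e^{4ρ} − 1 ≤ 8ρ`, `B7Prop1Explicit.exp4_sub_one_le`).  With `R = M = L^{k+1}` and `ρ = a₀` this is the END's
displayed regime `M·a₀ ≤ 1∕(300(d+1))`. [folklore] -/
theorem norm_fdiff_le_of_plaqDiv_periodic' (hd : 1 ≤ d) {Per : ℕ} (hPer : 1 ≤ Per) (A : Site d → Fin d → 𝕄)
    (hAP : IsPeriodicDir A (Per : ℤ)) {ρ J P : ℝ} (hρ : ρ ≤ 1 / 64)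
    (hA : ∀ (x : Site d) (κ : Fin d), ‖A x κ‖ ≤ ρ)
    (hJ : ∀ (x : Site d) (ν : Fin d),
      ‖∑ μ, ((((hol (vary (flat (d := d) (n := n)) A 1) x (plaqWord μ ν) : 𝕄ˣ) : 𝕄) - 1)
              - (((hol (vary (flat (d := d) (n := n)) A 1) (x - e μ) (plaqWord μ ν) : 𝕄ˣ) : 𝕄) - 1))‖ ≤ J)
    (hP : ∀ (x : Site d) (ν : Fin d), ‖∑ μ, (A (x + e ν) μ - A (x + e ν - e μ) μ) - ∑ μ, (A x μ - A (x - e μ) μ)‖ ≤ P)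
    {R : ℕ} (hR : 1 ≤ R) (hsmall : 128 * (d : ℝ) * R * ρ ≤ 1) (x : Site d) (κ τ : Fin d) :
    ‖A (x + e τ) κ - A x κ‖ ≤ 4 * ((d : ℝ) * ρ / R + R * (J + P)) := by
  have hρ0 : 0 ≤ ρ := (norm_nonneg _).trans (hA 0 ⟨0, hd⟩)
  refine norm_fdiff_le_of_plaqDiv_periodic hd hPer A hAP hA hJ hP hR ?_ x κ τ
  have h8 := exp4_sub_one_le hρ0 hρ
  calc 16 * (d : ℝ) * R * (Real.exp (4 * ρ) - 1) ≤ 16 * (d : ℝ) * R * (8 * ρ) := by gcongr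
    _ = 128 * (d : ℝ) * R * ρ := by ring
    _ ≤ 1 := hsmall

end Torus

end

end Summit.QuantumFields.BalabanUV.T4Continuum.NE7GradientCurrency
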